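import Summits.ValiantsHypothesis.ValiantsHypothesis.Theorems.BarrierLeverHubLemma

/-!
# Route BarrierLever — toolkit for hub certificates (TT, item 19152 / residual 19761)

Library file (`--supports stmt-ValiantsHypothesis-19152`; cell valiant-natproofs, rung V4, 𝒟-side of door (c);
prover gen 8, memo `HOME/prover/gen8/HUB-MEMO-g8.md` §1–§2). It does NOT import the route file. Three small
lemmas that make the hub lemma `Hub.alive_trans_of_hub` (`…Theorems.BarrierLeverHubLemma`) and the
compression move (`…Theorems.BarrierLeverCompressionMove`) usable as a certificate checker:

* `alive_symm` — aliveness of a pair of configurations is symmetric (transpose the matrix);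
* `alive_of_rearrangement` — the END of a compression word: if every column map is a member of the row
  family `H` (strictly increasing rows, injective) composed with a slot permutation, each member used once,
  then `(H, K)` is alive (the identity matrix gives a signed permutation matrix);
* `hub_unique_of_threshold` — the uniqueness hypothesis of the hub lemma from a DECIDABLE threshold
  condition: if every strictly increasing `h`-tuple is either a member of `H` or `ψ`-lighter than every
  member, then any injective family with increasing rows and the same total `ψ`-weight is a permutation of
  `H` (the `r` heaviest sets are the unique family of maximal total weight).

WHAT THIS IS NOT: bookkeeping; nothing on the existence of certificates, on TT / TNS / item 19717 in
general, on crux stmt-ValiantsHypothesis-14610, or on `VP` versus `VNP`.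
-/

-- layout Summits/ValiantsHypothesis/ValiantsHypothesis forces the duplicated namespace component
set_option linter.dupNamespace false

namespace Summit.ValiantsHypothesis.ValiantsHypothesis.Theorems.BarrierLever.Hub

open Finset Matrix

variable {n h r : ℕ}

/-- Aliveness is symmetric in the two configurations (transpose the witness). -/
theorem alive_symm {ι : Type*} [Fintype ι] [DecidableEq ι] (S T : ι → Fin h → Fin n)
    (hST : ∃ G : Matrix (Fin n) (Fin n) ℂ,
      (Matrix.of fun i j : ι => (G.submatrix (S i) (T j)).det).det ≠ 0) :
    ∃ G : Matrix (Fin n) (Fin n) ℂ,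
      (Matrix.of fun i j : ι => (G.submatrix (T i) (S j)).det).det ≠ 0 := by
  obtain ⟨G, hG⟩ := hST
  refine ⟨Gᵀ, ?_⟩
  have : (Matrix.of fun i j : ι => (Gᵀ.submatrix (T i) (S j)).det) =
      (Matrix.of fun i j : ι => (G.submatrix (S i) (T j)).det)ᵀ := by
    refine Matrix.ext fun i j => ?_
    rw [Matrix.of_apply, Matrix.transpose_apply, Matrix.of_apply, ← Matrix.transpose_submatrix,
      Matrix.det_transpose]
  rw [this, Matrix.det_transpose]
  exact hG

/-- A minor of the identity matrix through an injective row map `ρ` and a column map `κ` some of whose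
values is not a value of `ρ`... more precisely: if some value of `ρ` is not a value of `κ`, the minor
`det 1[ρ, κ]` vanishes (a zero row). -/
theorem det_one_submatrix_eq_zero {e : ℕ} (ρ κ : Fin e → Fin n) (a : Fin e)
    (ha : ∀ b, κ b ≠ ρ a) :
    ((1 : Matrix (Fin n) (Fin n) ℂ).submatrix ρ κ).det = 0 := by
  refine Matrix.det_eq_zero_of_row_eq_zero a (fun b => ?_)
  rw [Matrix.submatrix_apply, Matrix.one_apply_ne (fun h => ha b h.symm)]

/-- The minor of the identity matrix through `ρ` and `ρ ∘ τ` (`ρ` injective, `τ` a slot permutation) is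
`sign τ`. -/
theorem det_one_submatrix_comp_perm {e : ℕ} (ρ : Fin e → Fin n) (hρ : Function.Injective ρ)
    (τ : Equiv.Perm (Fin e)) :
    ((1 : Matrix (Fin n) (Fin n) ℂ).submatrix ρ (ρ ∘ τ)).det = ((Equiv.Perm.sign τ : ℤˣ) : ℤ) := by
  have h1 : (1 : Matrix (Fin n) (Fin n) ℂ).submatrix ρ (ρ ∘ τ) =
      ((1 : Matrix (Fin e) (Fin e) ℂ)).submatrix id τ := by
    ext a b
    by_cases hab : a = τ b
    · rw [Matrix.submatrix_apply, Matrix.submatrix_apply, Function.comp_apply, id_eq, hab,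
        Matrix.one_apply_eq, Matrix.one_apply_eq]
    · have hne : ρ a ≠ ρ (τ b) := fun h => hab (hρ h)
      rw [Matrix.submatrix_apply, Matrix.submatrix_apply, Function.comp_apply, id_eq,
        Matrix.one_apply_ne hne, Matrix.one_apply_ne hab]
  rw [h1, Matrix.det_permute', Matrix.det_one, mul_one]

/-- **End of a compression word.** If the column maps are the members of `H` (strictly increasing,
pairwise distinct) in some order `π`, each composed with a slot permutation, then `(H, K)` is alive:
the identity matrix makes the layout matrix a signed permutation matrix. -/
theorem alive_of_rearrangement (H K : Fin r → Fin h → Fin n)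
    (hHm : ∀ j, StrictMono (H j)) (hHi : Function.Injective H)
    (π : Equiv.Perm (Fin r)) (τ : Fin r → Equiv.Perm (Fin h)) (hK : ∀ j, K j = H (π j) ∘ (τ j)) :
    ∃ G : Matrix (Fin n) (Fin n) ℂ,
      (Matrix.of fun i j : Fin r => (G.submatrix (H i) (K j)).det).det ≠ 0 := by
  refine ⟨1, ?_⟩
  -- the layout matrix is the signed permutation matrix  (i, j) ↦ [i = π j] · sign (τ j)
  have hL : (Matrix.of fun i j : Fin r => ((1 : Matrix (Fin n) (Fin n) ℂ).submatrix (H i) (K j)).det) =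
      (Matrix.of fun i j : Fin r => (if i = π j then (1 : ℂ) else 0) *
        (((Equiv.Perm.sign (τ j) : ℤˣ) : ℤ) : ℂ)) := by
    refine Matrix.ext fun i j => ?_
    rw [Matrix.of_apply, Matrix.of_apply, hK j]
    by_cases hij : i = π j
    · subst hij
      rw [det_one_submatrix_comp_perm _ (hHm _).injective, if_pos rfl, one_mul]
    · -- ranges of H i and H (π j) differ: some value of H i is missed by H (π j) ∘ τ j
      have hne : H i ≠ H (π j) := fun hEq => hij (hHi hEq)
      have hrange : Set.range (H i) ≠ Set.range (H (π j)) := fun hEq =>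
        hne ((hHm i).range_inj (hHm (π j)) |>.mp hEq)
      have : ∃ a, ∀ b, (H (π j) ∘ τ j) b ≠ H i a := by
        by_contra hcon
        push Not at hcon
        apply hrange
        apply Set.Subset.antisymm
        · rintro _ ⟨a, rfl⟩
          obtain ⟨b, hb⟩ := hcon a
          exact ⟨τ j b, hb⟩
        · -- equal cardinalities: range (H (π j)) ⊆ range (H i) from the other inclusion and card
          have hsub : Set.range (H i) ⊆ Set.range (H (π j)) := by
            rintro _ ⟨a, rfl⟩
            obtain ⟨b, hb⟩ := hcon a
            exact ⟨τ j b, hb⟩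
          have hfin : (Finset.univ.image (H i)) = Finset.univ.image (H (π j)) := by
            apply Finset.eq_of_subset_of_card_le
            · intro v hv
              rw [Finset.mem_image] at hv ⊢
              obtain ⟨a, _, rfl⟩ := hv
              obtain ⟨b, hb⟩ := hcon a
              exact ⟨τ j b, Finset.mem_univ _, hb⟩
            · rw [Finset.card_image_of_injective _ (hHm (π j)).injective,
                Finset.card_image_of_injective _ (hHm i).injective]
          intro v hv
          obtain ⟨b, rfl⟩ := hv
          have : H (π j) b ∈ Finset.univ.image (H i) := by
            rw [hfin]; exact Finset.mem_image_of_mem _ (Finset.mem_univ b)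
          rw [Finset.mem_image] at this
          obtain ⟨a, _, ha⟩ := this
          exact ⟨a, ha⟩
      obtain ⟨a, ha⟩ := this
      rw [det_one_submatrix_eq_zero (H i) (H (π j) ∘ τ j) a ha, if_neg hij, zero_mul]
  rw [hL]
  -- a signed permutation matrix: permutation matrix of π⁻¹ times a diagonal of signs
  have hfac : (Matrix.of fun i j : Fin r => (if i = π j then (1 : ℂ) else 0) *
      (((Equiv.Perm.sign (τ j) : ℤˣ) : ℤ) : ℂ)) =
      ((Equiv.toPEquiv π.symm).toMatrix : Matrix (Fin r) (Fin r) ℂ) *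
        Matrix.diagonal (fun j => (((Equiv.Perm.sign (τ j) : ℤˣ) : ℤ) : ℂ)) := by
    refine Matrix.ext fun i j => ?_
    rw [Matrix.mul_diagonal, Matrix.of_apply, PEquiv.toMatrix_apply, Equiv.toPEquiv_apply]
    congr 1
    simp only [Option.mem_def, Option.some.injEq, Equiv.symm_apply_eq]
  rw [hfac, Matrix.det_mul, Matrix.det_permutation, Matrix.det_diagonal]
  refine mul_ne_zero ?_ ?_
  · exact Int.cast_ne_zero.mpr (Units.ne_zero _)
  · exact Finset.prod_ne_zero_iff.mpr fun j _ => Int.cast_ne_zero.mpr (Units.ne_zero _)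

/-- **Uniqueness from a threshold condition.** If every strictly increasing `h`-tuple is a member of `H`
or `ψ`-lighter than every member of `H`, then an injective family with strictly increasing rows and the
same total `ψ`-weight as `H` is a permutation of `H`. This discharges the hypothesis `hH` of
`alive_trans_of_hub` by a finite check (`decide` over the `h`-tuples). -/
theorem hub_unique_of_threshold (H : Fin r → Fin h → Fin n) (ψ : Fin n → ℕ)
    (hHi : Function.Injective H)
    (hthr : ∀ a : Fin h → Fin n, StrictMono a →
      (∃ j, a = H j) ∨ ∀ j, (∑ c, ψ (a c)) < ∑ c, ψ (H j c))
    (H' : Fin r → Fin h → Fin n) (hH'm : ∀ j, StrictMono (H' j)) (hH'i : Function.Injective H')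
    (hsum : (∑ j, ∑ a, ψ (H' j a)) = ∑ j, ∑ a, ψ (H j a)) :
    ∃ σ : Equiv.Perm (Fin r), ∀ j, H' j = H (σ j) := by
  classical
  let wt : (Fin h → Fin n) → ℕ := fun a => ∑ c, ψ (a c)
  set M : Finset (Fin h → Fin n) := Finset.univ.image H with hM
  set M' : Finset (Fin h → Fin n) := Finset.univ.image H' with hM'
  have hcard : M.card = r := by
    rw [hM, Finset.card_image_of_injective _ hHi, Finset.card_univ, Fintype.card_fin]
  have hcard' : M'.card = r := by
    rw [hM', Finset.card_image_of_injective _ hH'i, Finset.card_univ, Fintype.card_fin]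
  have hsumM : ∑ a ∈ M, wt a = ∑ j, wt (H j) := by rw [hM, Finset.sum_image (fun x _ y _ hxy => hHi hxy)]
  have hsumM' : ∑ a ∈ M', wt a = ∑ j, wt (H' j) := by
    rw [hM', Finset.sum_image (fun x _ y _ hxy => hH'i hxy)]
  -- every member of M' outside M is lighter than every member of M
  have hlight : ∀ a ∈ M' \ M, ∀ b ∈ M, wt a < wt b := by
    intro a ha b hb
    rw [Finset.mem_sdiff] at ha
    have haM' := ha.1
    rw [hM', Finset.mem_image] at haM'
    obtain ⟨j', _, rfl⟩ := haM'
    rw [hM, Finset.mem_image] at hb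
    obtain ⟨j, _, rfl⟩ := hb
    rcases hthr (H' j') (hH'm j') with ⟨j₀, hj₀⟩ | hlt
    · exact absurd (by rw [hM, Finset.mem_image]; exact ⟨j₀, Finset.mem_univ _, hj₀.symm⟩) ha.2
    · exact hlt j
  -- hence M' = M (otherwise the total weight of M' is strictly smaller)
  have hMM' : M' = M := by
    by_contra hne
    have hk : (M' \ M).card = (M \ M').card := by
      have h1 := Finset.card_sdiff_add_card_inter M' M
      have h2 := Finset.card_sdiff_add_card_inter M M'
      rw [Finset.inter_comm] at h2
      omega
    have hne' : (M' \ M).Nonempty := by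
      rw [Finset.nonempty_iff_ne_empty]
      intro h0
      have hsub : M' ⊆ M := Finset.sdiff_eq_empty_iff_subset.mp h0
      exact hne (Finset.eq_of_subset_of_card_le hsub (by rw [hcard, hcard']))
    -- compare the sums over the two difference sets through a bijection
    obtain ⟨e⟩ : Nonempty (↥(M' \ M) ≃ ↥(M \ M')) := by
      rw [← Fintype.card_eq, Fintype.card_coe, Fintype.card_coe, hk]
    have hlt : ∑ a ∈ M' \ M, wt a < ∑ b ∈ M \ M', wt b := by
      rw [← Finset.sum_coe_sort (M' \ M), ← Finset.sum_coe_sort (M \ M')]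
      rw [← Fintype.sum_equiv e (fun a => wt (e a)) (fun b => wt b) (fun _ => rfl)]
      apply Finset.sum_lt_sum
      · intro a _
        exact (hlight a a.2 (e a) (Finset.mem_sdiff.mp (e a).2).1).le
      · obtain ⟨a, ha⟩ := hne'
        exact ⟨⟨a, ha⟩, Finset.mem_univ _, hlight a ha (e ⟨a, ha⟩) (Finset.mem_sdiff.mp (e ⟨a, ha⟩).2).1⟩
    have hdec : ∑ a ∈ M', wt a = ∑ a ∈ M' \ M, wt a + ∑ a ∈ M' ∩ M, wt a := by
      rw [add_comm]; exact (Finset.sum_inter_add_sum_sdiff M' M wt).symm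
    have hdec' : ∑ a ∈ M, wt a = ∑ a ∈ M \ M', wt a + ∑ a ∈ M ∩ M', wt a := by
      rw [add_comm]; exact (Finset.sum_inter_add_sum_sdiff M M' wt).symm
    have : ∑ a ∈ M', wt a < ∑ a ∈ M, wt a := by
      rw [hdec, hdec', Finset.inter_comm]
      exact Nat.add_lt_add_right hlt _
    rw [hsumM, hsumM'] at this
    exact absurd hsum (ne_of_lt this)
  -- read off the permutation
  have hex : ∀ j, ∃ i, H' j = H i := by
    intro j
    have : H' j ∈ M := by rw [← hMM', hM']; exact Finset.mem_image_of_mem _ (Finset.mem_univ j)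
    rw [hM, Finset.mem_image] at this
    obtain ⟨i, _, hi⟩ := this
    exact ⟨i, hi.symm⟩
  choose σf hσf using hex
  have hσf_inj : Function.Injective σf := by
    intro j j' hjj'
    apply hH'i
    rw [hσf j, hσf j', hjj']
  have hσf_bij : Function.Bijective σf := by
    rw [Fintype.bijective_iff_injective_and_card]
    exact ⟨hσf_inj, rfl⟩
  exact ⟨Equiv.ofBijective σf hσf_bij, fun j => hσf j⟩

end Summit.ValiantsHypothesis.ValiantsHypothesis.Theorems.BarrierLever.Hub
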